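import Literature.Computability.MetaComplexity.EFModMulUAssocS
import Literature.Computability.MetaComplexity.EFModAdd
import HarnessLib

/-!
# Uniform modular exponentiation: the template

Layer F/1. Modular exponentiation `E(z, w) = z^w mod n` on `L`-bit words by the product of
selected repeated squares, least significant exponent bit first:
`S₀ = z`, `S_{t+1} = S_t ⊗ S_t`; `F₀ = 1`, `F_{t+1} = F_t ⊗ G_t` with `G_t = mux(w_t, S_t, 1)`
bitwise; `E(z, w) = F_L`. The word `1 = (og, zz, …, zz)` uses the true gate `og` and the zero
gate `zz` (a kit input). The KIT `ModExpU.expT L` (`3L` pieces on the inputs `z, w, n, zz`),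
its views (`Sv`, `Gv`, `Fv`, the words `Sw`, `Fw`, `ONE`) and their availability.

## Sources

* H. Vollmer, *Introduction to Circuit Complexity* (Springer 1999), §1.2–1.3.
* J. Krajíček, *Bounded Arithmetic, Propositional Logic, and Complexity Theory* (CUP 1995), §9.2.
-/

namespace Literature.Computability.MetaComplexity

open _root_.Computability Complexity Complexity.PropForm Netlist Cluster FregeSystem

namespace ModExpU

open ModMulU

variable (L : ℕ)

/-! ### The pieces -/

/-- Offset of the mux rows. [folklore] -/
def oG (L : ℕ) : ℕ := 1 + (L - 1) * LD.RT L
/-- Offset of the accumulating multipliers. [folklore] -/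
def oF (L : ℕ) : ℕ := oG L + L * L

/-- Reference to bit `i` of the word `1`: the true gate (gate `0`) at `i = 0`, else the zero gate. [folklore] -/
def ONEref (i : ℕ) : ℕ ⊕ ℕ := if i = 0 then Sum.inr 0 else Sum.inl (3 * L)
/-- Reference to bit `i` of `S_t`. [folklore] -/
def Sref (t i : ℕ) : ℕ ⊕ ℕ := if t = 0 then Sum.inl i else Sum.inr (LD.pP L (1 + (t - 1) * LD.RT L) L i)
/-- Reference to bit `i` of `G_t`. [folklore] -/
def Gref (t i : ℕ) : ℕ ⊕ ℕ := Sum.inr (oG L + t * L + i)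
/-- Reference to bit `i` of `F_t`. [folklore] -/
def Fref (t i : ℕ) : ℕ ⊕ ℕ := if t = 0 then ONEref L i else Sum.inr (LD.pP L (oF L + (t - 1) * LD.RT L) L i)

/-- Wiring of `S_{t+1} = S_t ⊗ S_t`. [folklore] -/
def wS (t : ℕ) (i : ℕ) : ℕ ⊕ ℕ := if i < L then Sref L t i else if i < 2 * L then Sref L t (i - L) else Sum.inl i
/-- Wiring of `G_t = mux(w_t, S_t, 1)`. [folklore] -/
def wG (t : ℕ) (j : ℕ) : ℕ ⊕ ℕ := if j = 0 then Sum.inl (L + t) else if j ≤ L then Sref L t (j - 1) else ONEref L (j - 1 - L)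
/-- Wiring of `F_{t+1} = F_t ⊗ G_t`. [folklore] -/
def wF (t : ℕ) (i : ℕ) : ℕ ⊕ ℕ := if i < L then Fref L t i else if i < 2 * L then Gref L t (i - L) else Sum.inl i

/-- The pieces: the true gate, `S_1 … S_{L-1}`, `G_0 … G_{L-1}`, `F_1 … F_L`. [cite: Vollmer1999, §1.2] -/
def pieces (L : ℕ) (k : ℕ) : Piece :=
  if k = 0 then ⟨[⟨Kind.cst true, []⟩], 0, fun i => Sum.inl i⟩
  else if k < L then ⟨mulRT L, 3 * L, wS L (k - 1)⟩
  else if k < 2 * L then ⟨ModAdd.muxRow L, 2 * L + 1, wG L (k - L)⟩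
  else ⟨mulRT L, 3 * L, wF L (k - 2 * L)⟩

/-- Closed-form offsets. [folklore] -/
def offF (L : ℕ) (k : ℕ) : ℕ :=
  if k = 0 then 0 else if k ≤ L then 1 + (k - 1) * LD.RT L else if k ≤ 2 * L then oG L + (k - L) * L else oF L + (k - 2 * L) * LD.RT L

/-- **The modular exponentiation kit.** [cite: Vollmer1999, §1.2–1.3] -/
def expT (L : ℕ) : Template := layout (pieces L) (3 * L)

/-- The length of piece `k`. [folklore] -/
theorem length_piece (k : ℕ) : (pieces L k).T.length = if k = 0 then 1 else if k < L then LD.RT L else if k < 2 * L then L else LD.RT L := by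
  unfold pieces; split_ifs <;> simp [LD.RT, ML, ModAdd.length_muxRow]

/-- The closed form steps like the lengths. [folklore] -/
theorem offF_succ (hL : 0 < L) (k : ℕ) (hk : k < 3 * L) : offF L (k + 1) = offF L k + (pieces L k).T.length := by
  rw [length_piece]
  by_cases h0 : k = 0
  · subst h0; simp [offF, show 1 ≤ L from hL]
  have f0 : ¬(k + 1 = 0) := by omega
  by_cases h1 : k < L
  · have g1 : k + 1 ≤ L := by omega
    have g2 : k ≤ L := by omega
    simp only [offF, h0, f0, g1, g2, h1, if_false, if_true]
    rw [show k + 1 - 1 = k - 1 + 1 by omega]; ring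
  have g1 : ¬(k + 1 ≤ L) := by omega
  by_cases h2 : k < 2 * L
  · have g3 : k + 1 ≤ 2 * L := by omega
    by_cases h3 : k ≤ L
    · have e : L = k := by omega
      subst e
      simp only [offF, h0, f0, g1, h1, h2, g3, le_refl, if_false, if_true]
      rw [show L + 1 - L = 1 by omega]; unfold oG; ring
    · have g4 : k ≤ 2 * L := by omega
      simp only [offF, h0, f0, g1, h1, h2, g3, h3, g4, if_false, if_true]
      rw [show k + 1 - L = k - L + 1 by omega]; ring
  · have g3 : ¬(k + 1 ≤ 2 * L) := by omega
    have g5 : ¬(k ≤ L) := by omega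
    by_cases h3 : k ≤ 2 * L
    · have e : k = 2 * L := by omega
      subst e
      simp only [offF, h0, f0, g1, h1, h2, g3, g5, le_refl, if_false, if_true]
      rw [show 2 * L + 1 - 2 * L = 1 by omega, show 2 * L - L = L by omega]; unfold oF; ring
    · simp only [offF, h0, f0, g1, h1, h2, g3, g5, h3, if_false]
      rw [show k + 1 - 2 * L = k - 2 * L + 1 by omega]; ring

/-- **The offsets of the pieces are the closed forms.** [folklore] -/
theorem offset_pieces (hL : 0 < L) : ∀ k ≤ 3 * L, offset (pieces L) k = offF L k := by
  intro k hk
  induction k with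
  | zero => rfl
  | succ k ih => rw [offset_succ, ih (by omega), offF_succ L hL k (by omega)]

/-- References are in range: `1`. [folklore] -/
theorem ONEref_ok (i : ℕ) {off : ℕ} (hoff : 0 < off) : (∀ a, ONEref L i = Sum.inl a → a < 3 * L + 1) ∧ (∀ g, ONEref L i = Sum.inr g → g < off) := by
  unfold ONEref
  by_cases h : i = 0
  · rw [if_pos h]; exact ⟨fun a ha => (by cases ha), fun g hg => by cases hg; exact hoff⟩
  · rw [if_neg h]; exact ⟨fun a ha => (by cases ha; omega), fun g hg => by cases hg⟩

/-- References are in range: `S_t`. [folklore] -/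
theorem Sref_ok {t i : ℕ} (hi : i < L) {off : ℕ} (hoff : 1 + t * LD.RT L ≤ off) :
    (∀ a, Sref L t i = Sum.inl a → a < 3 * L + 1) ∧ (∀ g, Sref L t i = Sum.inr g → g < off) := by
  unfold Sref
  split_ifs with h
  · exact ⟨fun a ha => (by cases ha; omega), fun g hg => by cases hg⟩
  · refine ⟨fun a ha => (by cases ha), fun g hg => ?_⟩
    cases hg
    have := LD.pP_lt L (oV := 1 + (t - 1) * LD.RT L) (t := L) (i := i) le_rfl hi
    have e : 1 + (t - 1) * LD.RT L + LD.RT L = 1 + t * LD.RT L := by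
      rw [show t = t - 1 + 1 by omega, Nat.add_sub_cancel]; ring
    omega

/-- References are in range: `F_t`. [folklore] -/
theorem Fref_ok {t i : ℕ} (hi : i < L) {off : ℕ} (hoff : oF L + t * LD.RT L ≤ off) (hoff' : 0 < off) :
    (∀ a, Fref L t i = Sum.inl a → a < 3 * L + 1) ∧ (∀ g, Fref L t i = Sum.inr g → g < off) := by
  unfold Fref
  split_ifs with h
  · exact ONEref_ok L i hoff'
  · refine ⟨fun a ha => (by cases ha), fun g hg => ?_⟩
    cases hg
    have := LD.pP_lt L (oV := oF L + (t - 1) * LD.RT L) (t := L) (i := i) le_rfl hi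
    have e : oF L + (t - 1) * LD.RT L + LD.RT L = oF L + t * LD.RT L := by
      rw [show t = t - 1 + 1 by omega, Nat.add_sub_cancel]; ring
    omega

/-- Offsets of the squarings `S_t` (piece `t`, `1 ≤ t`). [folklore] -/
theorem offF_S {t : ℕ} (ht : 1 ≤ t) (ht' : t ≤ L) : offF L t = 1 + (t - 1) * LD.RT L := by
  unfold offF; rw [if_neg (by omega), if_pos ht']

/-- Offsets of the mux rows `G_t` (piece `L + t`). [folklore] -/
theorem offF_G {t : ℕ} (ht : t ≤ L) (hL : 0 < L) : offF L (L + t) = oG L + t * L := by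
  unfold offF
  rcases Nat.eq_zero_or_pos t with rfl | ht0
  · rw [if_neg (by omega), if_pos (by omega), Nat.add_zero, Nat.zero_mul, Nat.add_zero]; rfl
  · rw [if_neg (by omega), if_neg (by omega), if_pos (by omega), Nat.add_sub_cancel_left]

/-- Offsets of the accumulations `F_{t+1}` (piece `2L + t`). [folklore] -/
theorem offF_F {t : ℕ} (hL : 0 < L) : offF L (2 * L + t) = oF L + t * LD.RT L := by
  unfold offF
  rcases Nat.eq_zero_or_pos t with rfl | ht0
  · rw [if_neg (by omega), if_neg (by omega), if_pos (by omega), Nat.add_zero, Nat.zero_mul, Nat.add_zero, show 2 * L - L = L by omega]; rfl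
  · rw [if_neg (by omega), if_neg (by omega), if_neg (by omega), Nat.add_sub_cancel_left]

/-- Every piece is well formed and well wired (`3L + 1` inputs). [cite: Vollmer1999, Def. 1.6] -/
theorem piece_ok (hL : 0 < L) : ∀ k < 3 * L, Piece.OK (pieces L) (3 * L + 1) k := by
  intro k hk
  unfold Piece.OK
  rw [offset_pieces L hL k (by omega)]
  unfold pieces
  by_cases h0 : k = 0
  · subst h0; simp only [if_true]
    refine ⟨fun j hj => ?_, fun i hi => absurd hi (Nat.not_lt_zero _)⟩
    simp only [List.length_singleton] at hj
    have : j = 0 := by omega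
    subst this; exact ⟨rfl, fun a ha => by simp at ha⟩
  rw [if_neg h0]
  by_cases h1 : k < L
  · rw [if_pos h1, offF_S L (by omega) (by omega)]
    refine ⟨wf_mulRT L, fun i hi => ?_⟩
    dsimp only at hi ⊢; unfold wS
    split_ifs
    · exact Sref_ok L (by omega) (Nat.add_le_add_left (Nat.mul_le_mul_right _ (by omega)) _)
    · exact Sref_ok L (by omega) (Nat.add_le_add_left (Nat.mul_le_mul_right _ (by omega)) _)
    · exact ⟨fun a ha => (by cases ha; omega), fun g hg => by cases hg⟩
  rw [if_neg h1]
  by_cases h2 : k < 2 * L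
  · obtain ⟨t, rfl⟩ : ∃ t, k = L + t := ⟨k - L, by omega⟩
    rw [if_pos h2, offF_G L (by omega) hL, Nat.add_sub_cancel_left]
    refine ⟨ModAdd.wf_muxRow L, fun j hj => ?_⟩
    dsimp only at hj ⊢; unfold wG
    split_ifs with g1 g2
    · exact ⟨fun a ha => (by cases ha; omega), fun g hg => by cases hg⟩
    · refine Sref_ok L (by omega) ?_
      unfold oG; exact (Nat.add_le_add_left (Nat.mul_le_mul_right _ (show t ≤ L - 1 by omega)) _).trans (Nat.le_add_right _ _)
    · exact ONEref_ok L _ (by unfold oG; omega)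
  · obtain ⟨t, rfl⟩ : ∃ t, k = 2 * L + t := ⟨k - 2 * L, by omega⟩
    rw [if_neg h2, offF_F L hL, Nat.add_sub_cancel_left]
    refine ⟨wf_mulRT L, fun i hi => ?_⟩
    dsimp only at hi ⊢; unfold wF
    split_ifs with g1 g2
    · exact Fref_ok L g1 le_rfl (by unfold oF oG; omega)
    · refine ⟨fun a ha => (by cases ha), fun g hg => ?_⟩
      cases hg; unfold oF
      have ht : t + 1 ≤ L := by omega
      have hiL : i - L < L := by omega
      have : t * L + (i - L) < L * L := by
        calc t * L + (i - L) < t * L + L := by omega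
          _ = (t + 1) * L := by ring
          _ ≤ L * L := Nat.mul_le_mul_right _ ht
      nlinarith [Nat.zero_le (t * LD.RT L)]
    · exact ⟨fun a ha => (by cases ha; omega), fun g hg => by cases hg⟩

/-- **The kit is well formed** (`3L + 1` inputs). [cite: Vollmer1999, Def. 1.6] -/
theorem wf_expT (hL : 0 < L) : (expT L).WF (3 * L + 1) := wf_layout (pieces L) (piece_ok L hL)

/-! ### The views of an occurrence -/

section Views

variable (o : Occ)

/-- The base `z`. [folklore] -/
def zin (i : ℕ) : ℕ := o.inp i
/-- The exponent `w`. [folklore] -/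
def win (t : ℕ) : ℕ := o.inp (L + t)
/-- The modulus. [folklore] -/
def nin (i : ℕ) : ℕ := o.inp (2 * L + i)
/-- The zero gate. [folklore] -/
def zz : ℕ := o.inp (3 * L)
/-- The true gate. [folklore] -/
def og : ℕ := o.base
/-- The word `1`. [folklore] -/
def ONE (i : ℕ) : ℕ := if i = 0 then o.base else o.inp (3 * L)
/-- The words `S_t` (`S_0 = z`). [folklore] -/
def Sw (t i : ℕ) : ℕ := if t = 0 then o.inp i else o.base + LD.pP L (1 + (t - 1) * LD.RT L) L i
/-- The squaring `S_t = S_{t-1} ⊗ S_{t-1}` (`1 ≤ t`). [folklore] -/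
def Sv (t : ℕ) : View := ⟨o.base + (1 + (t - 1) * LD.RT L), Sw L o (t - 1), Sw L o (t - 1), nin L o⟩
/-- The mux words `G_t = mux(w_t, S_t, 1)`. [folklore] -/
def Gv (t i : ℕ) : ℕ := o.base + (oG L + t * L + i)
/-- The words `F_t` (`F_0 = 1`). [folklore] -/
def Fw (t i : ℕ) : ℕ := if t = 0 then ONE L o i else o.base + LD.pP L (oF L + (t - 1) * LD.RT L) L i
/-- The accumulation `F_{t+1} = F_t ⊗ G_t`. [folklore] -/
def Fv (t : ℕ) : View := ⟨o.base + (oF L + t * LD.RT L), Fw L o t, Gv L o t, nin L o⟩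
/-- The definition line of a mux gate. [folklore] -/
def gDef (t i : ℕ) : PropForm ℕ := biimp (var (Gv L o t i)) (muxF (var (win L o t)) (var (Sw L o t i)) (var (ONE L o i)))

/-- All pieces of the exponentiation kit are available. [folklore] -/
structure EAvail (K : PropForm ℕ) (Γ : Set (PropForm ℕ)) : Prop where
  /-- the true gate -/
  hog : ctx K (biimp (var (og o)) (const true)) ∈ Γ
  /-- the squarings -/
  hS : ∀ t, 1 ≤ t → t < L → (Sv L o t).RAvail L K Γ
  /-- the mux rows -/
  hG : ∀ t < L, ∀ i < L, ctx K (gDef L o t i) ∈ Γ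
  /-- the accumulations -/
  hF : ∀ t < L, (Fv L o t).RAvail L K Γ

end Views

variable {L} {o : Occ} {K : PropForm ℕ} {Γ : Set (PropForm ℕ)}

/-- The output of `S_t` is `S_{t+1}`'s word: `P_L(Sv t) = Sw t`. [folklore] -/
theorem Sw_succ {t i : ℕ} (ht : 1 ≤ t) : Sw L o t i = (Sv L o t).P L L i := by
  unfold Sw Sv; rw [if_neg (by omega)]; unfold LD.pP View.P; split_ifs <;> simp [Nat.add_assoc]

/-- `P_L(Fv t) = Fw (t + 1)`. [folklore] -/
theorem Fw_succ {t i : ℕ} : Fw L o (t + 1) i = (Fv L o t).P L L i := by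
  unfold Fw Fv; rw [if_neg (by omega), Nat.add_sub_cancel]; unfold LD.pP View.P; split_ifs <;> simp [Nat.add_assoc]

/-- The references resolve to the words. [folklore] -/
theorem ref_words (hL : 0 < L) {t i : ℕ} (hi : i < L) :
    (o.inst (3 * L + 1)).ref (ONEref L i) = ONE L o i ∧ (o.inst (3 * L + 1)).ref (Sref L t i) = Sw L o t i ∧
    (o.inst (3 * L + 1)).ref (Gref L t i) = Gv L o t i ∧ (o.inst (3 * L + 1)).ref (Fref L t i) = Fw L o t i := by
  refine ⟨?_, ?_, ?_, ?_⟩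
  · unfold ONEref ONE; split_ifs
    · rfl
    · exact Occ.ref_inl o (by omega)
  · unfold Sref Sw; split_ifs
    · exact Occ.ref_inl o (by omega)
    · rfl
  · rfl
  · unfold Fref Fw; split_ifs
    · unfold ONEref ONE; split_ifs
      · rfl
      · exact Occ.ref_inl o (by omega)
    · rfl

/-- The base of the occurrence of piece `k`. [folklore] -/
theorem base_q (hL : 0 < L) {k : ℕ} (hk : k ≤ 3 * L) : (pieceOcc (o.inst (3 * L + 1)) (pieces L) k).base = o.base + offF L k := by
  simp [pieceOcc, offset_pieces L hL k hk]

/-- Availability of the squarings. [folklore] -/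
theorem avail_S (hL : 0 < L) (ho : o.Avail (expT L) (3 * L + 1) K Γ) {t : ℕ} (ht : 1 ≤ t) (ht' : t < L) : (Sv L o t).RAvail L K Γ := by
  have pk : pieces L t = ⟨mulRT L, 3 * L, wS L (t - 1)⟩ := by unfold pieces; rw [if_neg (by omega), if_pos ht']
  have hq : (pieceOcc (o.inst (3 * L + 1)) (pieces L) t).Avail (mulRT L) (3 * L) K Γ := by
    have := Inst.DefsAvail.piece ho (k := t) (by omega) (by rw [pk]; exact wf_mulRT L); rw [pk] at this; exact this
  refine (ravail_ofOcc hq).congr ?_ (fun i hi => ?_) (fun i hi => ?_) (fun i hi => ?_)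
  · show o.base + (1 + (t - 1) * LD.RT L) = (pieceOcc (o.inst (3 * L + 1)) (pieces L) t).base; rw [base_q hL (by omega), offF_S L ht (by omega)]
  · show Sw L o (t - 1) i = (pieceOcc (o.inst (3 * L + 1)) (pieces L) t).inp i
    rw [inp_pieceOcc, pk]; dsimp only; unfold wS; rw [if_pos hi, (ref_words hL hi).2.1]
  · show Sw L o (t - 1) i = (pieceOcc (o.inst (3 * L + 1)) (pieces L) t).inp (L + i)
    rw [inp_pieceOcc, pk]; dsimp only; unfold wS
    rw [if_neg (show ¬L + i < L by omega), if_pos (show L + i < 2 * L by omega), Nat.add_sub_cancel_left, (ref_words hL hi).2.1]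
  · show o.inp (2 * L + i) = (pieceOcc (o.inst (3 * L + 1)) (pieces L) t).inp (2 * L + i)
    rw [inp_pieceOcc, pk]; dsimp only; unfold wS
    rw [if_neg (show ¬2 * L + i < L by omega), if_neg (show ¬2 * L + i < 2 * L by omega), Occ.ref_inl o (by omega)]

/-- Availability of the accumulations. [folklore] -/
theorem avail_F (hL : 0 < L) (ho : o.Avail (expT L) (3 * L + 1) K Γ) {t : ℕ} (ht : t < L) : (Fv L o t).RAvail L K Γ := by
  have pk : pieces L (2 * L + t) = ⟨mulRT L, 3 * L, wF L t⟩ := by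
    unfold pieces; rw [if_neg (by omega), if_neg (by omega), if_neg (by omega), Nat.add_sub_cancel_left]
  have hq : (pieceOcc (o.inst (3 * L + 1)) (pieces L) (2 * L + t)).Avail (mulRT L) (3 * L) K Γ := by
    have := Inst.DefsAvail.piece ho (k := 2 * L + t) (by omega) (by rw [pk]; exact wf_mulRT L); rw [pk] at this; exact this
  refine (ravail_ofOcc hq).congr ?_ (fun i hi => ?_) (fun i hi => ?_) (fun i hi => ?_)
  · show o.base + (oF L + t * LD.RT L) = (pieceOcc (o.inst (3 * L + 1)) (pieces L) (2 * L + t)).base; rw [base_q hL (by omega), offF_F L hL]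
  · show Fw L o t i = (pieceOcc (o.inst (3 * L + 1)) (pieces L) (2 * L + t)).inp i
    rw [inp_pieceOcc, pk]; dsimp only; unfold wF; rw [if_pos hi, (ref_words hL hi).2.2.2]
  · show Gv L o t i = (pieceOcc (o.inst (3 * L + 1)) (pieces L) (2 * L + t)).inp (L + i)
    rw [inp_pieceOcc, pk]; dsimp only; unfold wF
    rw [if_neg (show ¬L + i < L by omega), if_pos (show L + i < 2 * L by omega), Nat.add_sub_cancel_left, (ref_words hL hi).2.2.1]
  · show o.inp (2 * L + i) = (pieceOcc (o.inst (3 * L + 1)) (pieces L) (2 * L + t)).inp (2 * L + i)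
    rw [inp_pieceOcc, pk]; dsimp only; unfold wF
    rw [if_neg (show ¬2 * L + i < L by omega), if_neg (show ¬2 * L + i < 2 * L by omega), Occ.ref_inl o (by omega)]

/-- Availability of the mux rows and the true gate. [folklore] -/
theorem avail_G (hL : 0 < L) (ho : o.Avail (expT L) (3 * L + 1) K Γ) :
    ctx K (biimp (var (og o)) (const true)) ∈ Γ ∧ ∀ t < L, ∀ i < L, ctx K (gDef L o t i) ∈ Γ := by
  constructor
  · have p0 : pieces L 0 = ⟨[⟨Kind.cst true, []⟩], 0, fun i => Sum.inl i⟩ := by unfold pieces; rw [if_pos rfl]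
    have wf0 : Template.WF [⟨Kind.cst true, []⟩] 0 := fun k hk => by
      have hk' : k < 1 := hk
      have : k = 0 := by omega
      subst this; exact ⟨rfl, fun a ha => by simp at ha⟩
    have h0 : (pieceOcc (o.inst (3 * L + 1)) (pieces L) 0).Avail [⟨Kind.cst true, []⟩] 0 K Γ := by
      have := Inst.DefsAvail.piece ho (k := 0) (by omega) (by rw [p0]; exact wf0)
      rw [p0] at this; exact this
    have := h0 0 (by simp)
    simpa [Inst.body, Kind.body, Inst.wire, pieceOcc, offset_zero, og] using this
  · intro t ht i hi
    have pk : pieces L (L + t) = ⟨ModAdd.muxRow L, 2 * L + 1, wG L t⟩ := by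
      unfold pieces; rw [if_neg (by omega), if_neg (by omega), if_pos (by omega), Nat.add_sub_cancel_left]
    have hq : (pieceOcc (o.inst (3 * L + 1)) (pieces L) (L + t)).Avail (ModAdd.muxRow L) (2 * L + 1) K Γ := by
      have := Inst.DefsAvail.piece ho (k := L + t) (by omega) (by rw [pk]; exact ModAdd.wf_muxRow L); rw [pk] at this; exact this
    have := hq i (by rw [ModAdd.length_muxRow]; exact hi)
    rw [ModAdd.getElem_muxRow] at this
    have ew : ((pieceOcc (o.inst (3 * L + 1)) (pieces L) (L + t)).inst (2 * L + 1)).wire i = Gv L o t i := by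
      simp [Inst.wire, pieceOcc, offset_pieces L hL (L + t) (by omega), offF_G L ht.le hL, Gv, Nat.add_assoc]
    have e0 : ((pieceOcc (o.inst (3 * L + 1)) (pieces L) (L + t)).inst (2 * L + 1)).ref (Sum.inl 0) = win L o t := by
      rw [Occ.ref_inl _ (by omega), inp_pieceOcc, pk]; dsimp only; unfold wG; rw [if_pos rfl]; exact Occ.ref_inl o (by omega)
    have e1 : ((pieceOcc (o.inst (3 * L + 1)) (pieces L) (L + t)).inst (2 * L + 1)).ref (Sum.inl (1 + i)) = Sw L o t i := by
      rw [Occ.ref_inl _ (by omega), inp_pieceOcc, pk]; dsimp only; unfold wG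
      rw [if_neg (by omega), if_pos (by omega), show 1 + i - 1 = i by omega]; exact (ref_words hL hi).2.1
    have e2 : ((pieceOcc (o.inst (3 * L + 1)) (pieces L) (L + t)).inst (2 * L + 1)).ref (Sum.inl (1 + L + i)) = ONE L o i := by
      rw [Occ.ref_inl _ (by omega), inp_pieceOcc, pk]; dsimp only; unfold wG
      rw [if_neg (by omega), if_neg (by omega), show 1 + L + i - 1 - L = i by omega]; exact (ref_words (t := 0) hL hi).1
    simpa [Inst.body, Kind.body, Netlist.arg, ew, e0, e1, e2, gDef] using this

/-- **All pieces of an available occurrence of the exponentiation kit are available.** [folklore] -/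
theorem avail_ofOcc (hL : 0 < L) (ho : o.Avail (expT L) (3 * L + 1) K Γ) : EAvail L o K Γ :=
  ⟨(avail_G hL ho).1, fun _ ht ht' => avail_S hL ho ht ht', (avail_G hL ho).2, fun _ ht => avail_F hL ho ht⟩

end ModExpU

end Literature.Computability.MetaComplexity
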